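import Summits.ValiantsHypothesis.ValiantsHypothesis.Theses.DivisionGap
import Literature.Computability.AlgebraicComplexity.BurgisserBooleanPartsA3Steps
import Literature.Computability.AlgebraicComplexity.ArithCircuitProofs

/-!
# `ZeroOneTransfer` — negative lemma: the `VP_ℂ` hypothesis IS LOAD-BEARING

Crux `stmt-ValiantsHypothesis-5066` (`Theses.DivisionGap.ZeroOneTransfer`, route DivisionGap).
Standing disprover (cdisprove), `Cruxes/ZeroOneTransfer/Disproof.lean` §(A), restated with the
crux's literal conclusion and the hypothesis `IsVPFamily` deleted.

* `totalDegree_le_two_pow_complexity` — `deg g ≤ 2 ^ L(g)` over any commutative semiring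
  (Bürgisser's `deg ≤ 2^{size}` at an optimal fan-in-two circuit).
* `le_totalDegree_X_pow_mul` — over `ℝ≥0`, `N ≤ deg (X i ^ N · h)` for `h ≠ 0`.
* `zeroOneTransfer_false_without_VP` — the crux with `IsVPFamily` dropped is FALSE: the
  one-variable 0/1 family `f_n = X ^ 2 ^ 2 ^ ((2n)^n + 1)` beats every quasi-polynomial bound on
  `L(f_n h) + L(h)` at `n = c`, whatever the nonzero cofactor `h`.  Any proof of the crux must use
  `IsVPFamily` (at least its degree clause).
[folklore]
-/

namespace Summit.ValiantsHypothesis.ValiantsHypothesis.Theorems.ZeroOneTransfer.Negative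

open Literature.Computability.AlgebraicComplexity MvPolynomial
open scoped NNReal

noncomputable section

/-- Degree lower bound for complexity: `deg g ≤ 2 ^ L(g)` for every polynomial over a commutative
semiring (Bürgisser's `deg ≤ 2^{size}` at an optimal circuit). [cite: Burgisser2000TCS, Lemma 2.4 p. 77] -/
theorem totalDegree_le_two_pow_complexity {k : Type*} [CommSemiring k] {σ : Type*}
    (g : MvPolynomial σ k) : g.totalDegree ≤ 2 ^ complexity g := by
  obtain ⟨P, h2, hP, hsize⟩ := ArithCircuit.exists_computes_size_eq_complexity g
  rw [← hsize, ← show P.eval = g from hP]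
  exact totalDegree_eval_le_two_pow_size h2

/-- Over `ℝ≥0` a nonzero cofactor cannot lower the degree below that of a monomial factor:
`N ≤ deg (X i ^ N * h)` for `h ≠ 0`. [folklore] -/
theorem le_totalDegree_X_pow_mul {σ : Type*} (i : σ) (N : ℕ) {h : MvPolynomial σ ℝ≥0}
    (hh : h ≠ 0) : N ≤ ((X i : MvPolynomial σ ℝ≥0) ^ N * h).totalDegree := by
  classical
  obtain ⟨m, hm⟩ := MvPolynomial.ne_zero_iff.mp hh
  have hcoeff : coeff (Finsupp.single i N + m) ((X i : MvPolynomial σ ℝ≥0) ^ N * h) ≠ 0 := by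
    rw [X_pow_eq_monomial, coeff_monomial_mul]
    simpa using hm
  calc N ≤ (Finsupp.single i N + m).sum (fun _ e => e) := by
        rw [Finsupp.sum_add_index' (fun _ => rfl) (fun _ _ _ => rfl), Finsupp.sum_single_index rfl]
        exact Nat.le_add_right _ _
    _ ≤ _ := le_totalDegree (mem_support_iff.mpr hcoeff)

/-- **`ZeroOneTransfer` without `IsVPFamily` is false.**  Witness: `σ_n = Unit`,
`f_n = X ^ 2 ^ 2 ^ ((2n)^n + 1)` (coefficients `0/1`).  Given the alleged `c`, at `n = c` every
nonzero `h` has `deg (f_c h) ≥ 2 ^ 2 ^ ((2c)^c + 1)`, while `L(f_c h) ≤ 2 ^ ((log₂ c + c)^c) ≤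
2 ^ ((2c)^c)` forces `deg ≤ 2 ^ 2 ^ ((2c)^c)` — contradiction.  So the `VP_ℂ` hypothesis of the
crux (its degree clause at least) is load-bearing. [folklore] -/
theorem zeroOneTransfer_false_without_VP :
    ¬ (∀ (σ : ℕ → Type) [∀ n, Fintype (σ n)] (f : ∀ n, MvPolynomial (σ n) ℝ≥0),
        (∀ n m, MvPolynomial.coeff m (f n) = 0 ∨ MvPolynomial.coeff m (f n) = 1) →
        ∃ c : ℕ, ∀ n, ∃ h : MvPolynomial (σ n) ℝ≥0, h ≠ 0 ∧
          Literature.Computability.AlgebraicComplexity.complexity (f n * h) +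
            Literature.Computability.AlgebraicComplexity.complexity h ≤
              2 ^ ((Nat.log 2 n + c) ^ c)) := by
  intro H
  obtain ⟨c, hc⟩ := H (fun _ => Unit)
    (fun n => (X () : MvPolynomial Unit ℝ≥0) ^ 2 ^ 2 ^ ((2 * n) ^ n + 1))
    (by
      intro n m
      classical
      rw [X_pow_eq_monomial, coeff_monomial]
      split_ifs <;> simp)
  obtain ⟨h, hne, hle⟩ := hc c
  have hL : complexity ((X () : MvPolynomial Unit ℝ≥0) ^ 2 ^ 2 ^ ((2 * c) ^ c + 1) * h) ≤
      2 ^ ((Nat.log 2 c + c) ^ c) := (Nat.le_add_right _ _).trans hle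
  have hlog : Nat.log 2 c + c ≤ 2 * c := by
    have := Nat.log_le_self 2 c
    omega
  have hexp : (Nat.log 2 c + c) ^ c ≤ (2 * c) ^ c := Nat.pow_le_pow_left hlog c
  have hdeg := (le_totalDegree_X_pow_mul () (2 ^ 2 ^ ((2 * c) ^ c + 1)) hne).trans
    (totalDegree_le_two_pow_complexity _)
  have h1 : 2 ^ 2 ^ ((2 * c) ^ c + 1) ≤ 2 ^ 2 ^ ((2 * c) ^ c) := by
    calc 2 ^ 2 ^ ((2 * c) ^ c + 1) ≤ 2 ^ complexity _ := hdeg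
      _ ≤ 2 ^ 2 ^ ((Nat.log 2 c + c) ^ c) := Nat.pow_le_pow_right two_pos hL
      _ ≤ 2 ^ 2 ^ ((2 * c) ^ c) :=
          Nat.pow_le_pow_right two_pos (Nat.pow_le_pow_right two_pos hexp)
  have h2 : 2 ^ ((2 * c) ^ c + 1) ≤ 2 ^ ((2 * c) ^ c) :=
    (Nat.pow_le_pow_iff_right (by norm_num)).mp h1
  have h3 : (2 * c) ^ c + 1 ≤ (2 * c) ^ c := (Nat.pow_le_pow_iff_right (by norm_num)).mp h2
  omega

end

end Summit.ValiantsHypothesis.ValiantsHypothesis.Theorems.ZeroOneTransfer.Negative
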